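import Summits.QuantumFields.YangMills.Theorems.UnitScaleTiltProp7FlatSliceRegularityT3
import Summits.QuantumFields.YangMills.Theorems.UnitScaleTiltProp7FlatCurrentLinearisation
import Summits.QuantumFields.YangMills.Theorems.UnitScaleTiltProp7FlatCurlCurl
import HarnessLib

/-!
# Route `UnitScaleTilt`, crux K1 child «MinimiserStabilityRegPr» (stmt-QuantumFields-19200), registered stub `stub_prop7From14` (V3, skeleton v7
# cc37a1787726) — lane B «regularity of the constrained minimiser from the Euler–Lagrange system + print's H_k/G, NO line-average chart»:
# **THE ONE-STEP NONLINEAR SLICE REGULARITY AT THE d = 3 CARRIER, ASSEMBLED** — for a unitary-valued `V = 1 + Y` on the fine torus, a real component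
# `x = ℓ∘Y` on print's flat Landau slice whose TRUE current component `c²·ℓ∘(D^{1*}_V∂V)` is a multiplier current (the Euler–Lagrange equation in the
# form (127)): `sup|x| ≤ C_G·B + C_H·(sup|Q_{K−n}x| + C_G·B)`, `B = c²·3·(2af + 2f² + 16ag)`, `c = L^{K−n}`, ABSOLUTE `C_G`, `C_H`

Cell `ym3-torus` ∕ fleet seat `ym-ust-19200-p3` (WIDTH-LEVER lane B of V3; HUMAN RULING D-0037, YM ladder rung R3).  `--supports stmt-QuantumFields-19200
--as helper`.  WHAT THIS IS: the composition, with every hypothesis explicit, of the three lane-B files — `Prop7FlatSliceRegularity(T3).abs_le_of_critical_T3`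
(print's (127) ⇒ (133)–(136) on the flat slice, V1 letters, F3 letters of p1 g14), `Prop7FlatCurlCurl.dcsE_dcE_apply` (the V1 curl–curl operator
pointwise) and `Prop7FlatCurrentLinearisation.norm_div2_curl_sub_covDivT_le_T3` (the true current is the flat operator up to third order).  WHAT THIS IS
NOT: the two hypotheses it leaves standing are exactly the located inputs of the lane-B DAG — (F1/B4) the flat Landau GAUGE `R∂*x = 0` for the components of
`Y` ([Balaban1985RegularSpaces] Thm 2/4 at background 1 = RULING g20-№13's `stub_thm2CubeSeq`, XL, shared with V2′) and (B1) the Euler–Lagrange PORT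
«`ℓ∘(D^{1*}_V∂V)` is a multiplier current of the straight block average» (★ym-ust-19200-p2's k-fold E–L `…Prop8EulerLagrangeIter/Family` in multiplier form ∘ the
port `Q^{(k)} = L^k·Q_k − dΛ_k` of `…Prop7IterLinStructure` ∘ gauge invariance of the current `…Prop8GaugeCurrent`); nothing of Bałaban's analysis is asserted
and no gauge is constructed.  In `η`-units (`a ~ f ~ g ~ ε`) the bound reads `sup|x| ≲ ε² + sup|Q_kx|` — the shape of [Balaban1985Variational] (165)/(136)
for ONE step of the bootstrap (the constraint datum `Q_kx` is the consumer's: lane A's true-linearisation files bound it by `ε₁ + ε²`-type data).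
NOT a claim about the mass gap.
APPENDED (same seat): `norm_flatOp_le_of_shift_diff` (the flat operator of a bond field is a signed sum of `4d` translation differences) and the CHART FORM
**`abs_component_le_of_slice_of_EL_chart_T3`** — the component is taken of an arbitrary bond field `A` (e.g. `log V`, on which the Landau gauge is imposed)
whose translation differences are within `q` of those of `V − 1`; remainder `B′ = c²·(3(2af + 2f² + 16ag) + 12q)`.

References: T. Bałaban, CMP **102** (1985) 277–309 [Balaban1985Variational] ((127) p.297, (133)–(136) p.298, (165) p.303); CMP **99** (1985) 75–102
[Balaban1985RegularSpaces] ((1.2) p.76, Prop. 6 (1.136) p.99).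
-/

set_option autoImplicit false

noncomputable section

open scoped BigOperators InnerProductSpace

namespace Summit.QuantumFields.YangMills.Theorems.Prop7FlatSliceRegularityNonlinear

open scoped Matrix.Norms.L2Operator
open Literature.MathematicalPhysics.QuantumFieldTheory.Balaban1983to89
open Literature.MathematicalPhysics.QuantumFieldTheory.BalabanImbrieJaffe1984to88.BIJ85AxialPropagator411 (BondSpace)
open LatticeFieldCalculus B6SectADomainsV1 B6SectAOperatorsV1 B6SectAVectorModelV1 B6SectCTwoScaleV1 B6GOneLevelV1Bridge
open T3ContinuumYM3Torus (T3Family)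
open Prop7FlatCoercivityR (succ_le_T3)
open B10Eq68TorusRegularity (plaqFT covDivT)
open B7Prop2Explicit (unitaryUnits)
open B5Hk163Decay (MG163)
open B5Hk163Strip (kappa163)
open B4TorusKernel (periodConst)
open B4Sect5Proof (latticeConst)
open B5G183Strip (kappa183)
open B5G183CovDecay (MD183)
open Prop7FlatSliceRegularity (abs_le_of_critical_T3)
open Prop7FlatCurrentLinearisation (norm_div2_curl_sub_covDivT_le_T3)
open Prop7FlatCurlCurl (dcsE_dcE_apply)

/-- **ONE-STEP NONLINEAR SLICE REGULARITY AT THE d = 3 CARRIER, MODULO THE GAUGE AND THE EULER–LAGRANGE PORT.**  Let `V` be a unitary-valued units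
configuration of `M₂(ℂ)` on the fine torus of run `K` (e.g. `unitsField (toUField U)` for the `SU(2)` field `U`), `V = 1 + Y` with `‖Y‖ ≤ a`, plaquette
variables within `f ≤ 1` of `1`, bond gradients `‖Y(b − e_ν) − Y(b)‖ ≤ g`; let `ℓ` be a real-linear functional on `M₂(ℂ)` of norm `≤ 1` (a real component) and
`x = ℓ∘Y` the corresponding real bond field.  IF `x` lies on print's flat Landau slice `R∂*x = 0` (one level at `j = K − n`, lattice factor `c = L^{K−n}`,
weights `c³`) AND the component `c²·ℓ∘(D^{1*}_V ∂V)` of the TRUE current ([Balaban1985RegularSpaces] (1.2)) is a multiplier current — `⟪δ, c²·ℓ∘J⟫ = 0`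
for every `δ` with `Q_{K−n}δ = 0` (the Euler–Lagrange equation of the constrained problem in the form (127), flat one-step reading) — and `sup|Q_{K−n}x| ≤ β`,
THEN `|x(e)| ≤ C_G·B + C_H·(β + C_G·B)` with `B = c²·3·(2af + 2f² + 16ag)` and the ABSOLUTE constants `C_G = C_sup(3)`, `C_H = C_H(3)` of
`Prop7FlatSliceRegularity.abs_le_of_slice_T3`.  (Assembly of `abs_le_of_critical_T3` ∘ `Prop7FlatCurlCurl.dcsE_dcE_apply` ∘
`Prop7FlatCurrentLinearisation.norm_div2_curl_sub_covDivT_le_T3`; in `η`-units `a ~ f ~ g ~ ε`, so `B ~ ε²`: the (165)/(136) shape.)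
[cite: Balaban1985Variational, (127) p.297, (133)-(136) p.298, (165) p.303; Balaban1985RegularSpaces, (1.2) p.76, (1.136) p.99] -/
theorem abs_component_le_of_slice_of_EL_T3 (F : T3Family) (n K : ℕ)
    {w : BondIdx (twoScale (K - n) (succ_le_T3 F n K) (∅ : Finset (Site (F.P K) (K - n + 1)))) → ℝ}
    (hw : ∀ i, 0 < w i) (hwa : ∀ p, w p = ((F.L : ℝ) ^ (K - n)) ^ 3)
    (V : GaugeField (F.P K) 0 (Matrix (Fin 2) (Fin 2) ℂ)ˣ) (hV : ∀ b, V b ∈ unitaryUnits (Matrix (Fin 2) (Fin 2) ℂ))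
    {a f g : ℝ} (ha : 0 ≤ a) (hf : 0 ≤ f) (hg : 0 ≤ g)
    (haV : ∀ b, ‖(V b : Matrix (Fin 2) (Fin 2) ℂ) - 1‖ ≤ a)
    (hfV : ∀ (s : Site (F.P K) 0) (κ μ : Fin 3), ‖plaqFT V κ μ s - 1‖ ≤ f)
    (hgV : ∀ (s : Site (F.P K) 0) (κ ν : Fin 3), ‖(V ⟨s.unshift ν, κ⟩ : Matrix (Fin 2) (Fin 2) ℂ) - V ⟨s, κ⟩‖ ≤ g)
    (ℓ : Matrix (Fin 2) (Fin 2) ℂ →L[ℝ] ℝ) (hℓ : ‖ℓ‖ ≤ 1)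
    (x : BondSpace (F.P K)) (hx : ∀ b, x b = ℓ ((V b : Matrix (Fin 2) (Fin 2) ℂ) - 1))
    (hslice : RE (twoScale (K - n) (succ_le_T3 F n K) (∅ : Finset (Site (F.P K) (K - n + 1)))) ((F.L : ℝ) ^ (K - n))
      (dsE ((F.L : ℝ) ^ (K - n)) x) = 0)
    (hEL : ∀ δ : BondSpace (F.P K), QE (twoScale (K - n) (succ_le_T3 F n K) (∅ : Finset (Site (F.P K) (K - n + 1)))) δ = 0 →
      ⟪δ, WithLp.toLp 2 (fun b : PBond (F.P K) 0 => ((F.L : ℝ) ^ (K - n)) ^ 2 * ℓ (covDivT 1 V b.dir b.src))⟫_ℝ = 0)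
    {β : ℝ} (hβ : ∀ c', |bondAvgIter (K - n) (WithLp.ofLp x) c'| ≤ β) (e : PBond (F.P K) 0) :
    |x e| ≤ (16 * Real.exp (1 / 6) * latticeConst 3 (1 / 6) + 3 * (MD183 3 2 * periodConst (kappa183 3) 2 * latticeConst 3 (kappa183 3 / 3)))
        * (((F.L : ℝ) ^ (K - n)) ^ 2 * (3 * (2 * a * f + 2 * f ^ 2 + 16 * a * g)))
      + MG163 3 * periodConst (kappa163 3) 2 * (3 * latticeConst 3 (kappa163 3 / 3))
        * (β + (16 * Real.exp (1 / 6) * latticeConst 3 (1 / 6)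
            + 3 * (MD183 3 2 * periodConst (kappa183 3) 2 * latticeConst 3 (kappa183 3 / 3)))
            * (((F.L : ℝ) ^ (K - n)) ^ 2 * (3 * (2 * a * f + 2 * f ^ 2 + 16 * a * g)))) := by
  set c : ℝ := (F.L : ℝ) ^ (K - n) with hc
  -- the remainder `r := c²·ℓ∘J − ∂*∂x`
  set r : BondSpace (F.P K) := WithLp.toLp 2 (fun b : PBond (F.P K) 0 => c ^ 2 * ℓ (covDivT 1 V b.dir b.src)) - dcsE c (dcE c x) with hr
  have hcrit : ∀ δ : BondSpace (F.P K), QE (twoScale (K - n) (succ_le_T3 F n K) (∅ : Finset (Site (F.P K) (K - n + 1)))) δ = 0 →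
      ⟪δ, dcsE c (dcE c x) + r⟫_ℝ = 0 := by
    intro δ hδ
    rw [hr, add_sub_cancel]
    exact hEL δ hδ
  -- the pointwise bound on `r` from the current linearisation and the curl–curl identity
  have hrB : ∀ e', |r e'| ≤ c ^ 2 * (3 * (2 * a * f + 2 * f ^ 2 + 16 * a * g)) := by
    intro e'
    have hflat := norm_div2_curl_sub_covDivT_le_T3 F K V hV ha hf hg haV hfV hgV e'.src e'.dir
    -- the linear functional applied to the flat operator is `c⁻²·(∂*∂x)(e')`
    have hlin : ℓ (∑ ν : Fin 3,
        ((((V ⟨e'.src.unshift ν, ν⟩ : Matrix (Fin 2) (Fin 2) ℂ) - 1) + ((V ⟨(e'.src.unshift ν).shift ν, e'.dir⟩ : Matrix (Fin 2) (Fin 2) ℂ) - 1)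
            - ((V ⟨(e'.src.unshift ν).shift e'.dir, ν⟩ : Matrix (Fin 2) (Fin 2) ℂ) - 1) - ((V ⟨e'.src.unshift ν, e'.dir⟩ : Matrix (Fin 2) (Fin 2) ℂ) - 1))
          - (((V ⟨e'.src, ν⟩ : Matrix (Fin 2) (Fin 2) ℂ) - 1) + ((V ⟨e'.src.shift ν, e'.dir⟩ : Matrix (Fin 2) (Fin 2) ℂ) - 1)
            - ((V ⟨e'.src.shift e'.dir, ν⟩ : Matrix (Fin 2) (Fin 2) ℂ) - 1) - ((V ⟨e'.src, e'.dir⟩ : Matrix (Fin 2) (Fin 2) ℂ) - 1))))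
        = ∑ ν : Fin 3,
          ((x ⟨e'.src.unshift ν, ν⟩ + x ⟨(e'.src.unshift ν).shift ν, e'.dir⟩ - x ⟨(e'.src.unshift ν).shift e'.dir, ν⟩ - x ⟨e'.src.unshift ν, e'.dir⟩)
            - (x ⟨e'.src, ν⟩ + x ⟨e'.src.shift ν, e'.dir⟩ - x ⟨e'.src.shift e'.dir, ν⟩ - x ⟨e'.src, e'.dir⟩)) := by
      simp only [map_sum, map_sub, map_add, hx]
    have hd : dcsE c (dcE c x) e' = c ^ 2 * ∑ ν : Fin 3,
          ((x ⟨e'.src.unshift ν, ν⟩ + x ⟨(e'.src.unshift ν).shift ν, e'.dir⟩ - x ⟨(e'.src.unshift ν).shift e'.dir, ν⟩ - x ⟨e'.src.unshift ν, e'.dir⟩)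
            - (x ⟨e'.src, ν⟩ + x ⟨e'.src.shift ν, e'.dir⟩ - x ⟨e'.src.shift e'.dir, ν⟩ - x ⟨e'.src, e'.dir⟩)) :=
      dcsE_dcE_apply c x e'
    have hre : r e' = c ^ 2 * (ℓ (covDivT 1 V e'.dir e'.src) - ℓ (∑ ν : Fin 3,
        ((((V ⟨e'.src.unshift ν, ν⟩ : Matrix (Fin 2) (Fin 2) ℂ) - 1) + ((V ⟨(e'.src.unshift ν).shift ν, e'.dir⟩ : Matrix (Fin 2) (Fin 2) ℂ) - 1)
            - ((V ⟨(e'.src.unshift ν).shift e'.dir, ν⟩ : Matrix (Fin 2) (Fin 2) ℂ) - 1) - ((V ⟨e'.src.unshift ν, e'.dir⟩ : Matrix (Fin 2) (Fin 2) ℂ) - 1))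
          - (((V ⟨e'.src, ν⟩ : Matrix (Fin 2) (Fin 2) ℂ) - 1) + ((V ⟨e'.src.shift ν, e'.dir⟩ : Matrix (Fin 2) (Fin 2) ℂ) - 1)
            - ((V ⟨e'.src.shift e'.dir, ν⟩ : Matrix (Fin 2) (Fin 2) ℂ) - 1) - ((V ⟨e'.src, e'.dir⟩ : Matrix (Fin 2) (Fin 2) ℂ) - 1))))) := by
      rw [hr, PiLp.sub_apply, hd, hlin]
      ring
    rw [hre, ← map_sub, abs_mul, abs_of_nonneg (by positivity : (0 : ℝ) ≤ c ^ 2)]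
    refine mul_le_mul_of_nonneg_left ?_ (by positivity)
    have key : ∀ v : Matrix (Fin 2) (Fin 2) ℂ, |ℓ v| ≤ ‖v‖ := fun v => by
      have h := ℓ.le_opNorm v
      rw [Real.norm_eq_abs] at h
      exact h.trans (mul_le_of_le_one_left (norm_nonneg v) hℓ)
    refine (key _).trans ?_
    rw [norm_sub_rev]
    exact hflat
  exact abs_le_of_critical_T3 F n K hw hwa x r hslice hcrit hrB hβ e

/-! ## Appended: the CHART form — `x = ℓ∘A` for any bond field `A` close to `V − 1` in translation differences (e.g. the Lie-algebra coordinate of `V = exp A`) -/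

/-- The flat operator of a bond field `E` at a bond is a signed sum of `4d` translation differences of `E`: if `‖E(s − e_ν, κ) − E(s, κ)‖ ≤ q` for all
`s, κ, ν` then `‖Σ_ν [C_E(x − e_ν; ν, μ) − C_E(x; ν, μ)]‖ ≤ 4·d·q`. [folklore] -/
theorem norm_flatOp_le_of_shift_diff {P : Params} {s₀ : ℕ} {M : Type*} [SeminormedAddCommGroup M] (E : PBond P s₀ → M) {q : ℝ}
    (hq : ∀ (s : Site P s₀) (κ ν : Fin P.d), ‖E ⟨s.unshift ν, κ⟩ - E ⟨s, κ⟩‖ ≤ q) (x : Site P s₀) (μ : Fin P.d) :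
    ‖∑ ν : Fin P.d, ((E ⟨x.unshift ν, ν⟩ + E ⟨(x.unshift ν).shift ν, μ⟩ - E ⟨(x.unshift ν).shift μ, ν⟩ - E ⟨x.unshift ν, μ⟩)
        - (E ⟨x, ν⟩ + E ⟨x.shift ν, μ⟩ - E ⟨x.shift μ, ν⟩ - E ⟨x, μ⟩))‖ ≤ 4 * P.d * q := by
  have s1 : ∀ (y : Site P s₀) (ν : Fin P.d), (y.unshift ν).shift ν = y := fun y ν => Site.shift_unshift y ν
  have s2 : ∀ (y : Site P s₀) (ν : Fin P.d), (y.shift ν).unshift ν = y := fun y ν => Site.unshift_shift y ν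
  have s3 : ∀ (y : Site P s₀) (μ ν : Fin P.d), (y.unshift ν).shift μ = (y.shift μ).unshift ν := fun y μ ν => by
    funext κ
    simp only [Site.shift_apply, Site.unshift_apply]
    by_cases h1 : κ = ν <;> by_cases h2 : κ = μ
    · subst h1; subst h2; simp
    · subst h1; simp [h2]
    · subst h2; simp [h1]
    · simp [h1, h2]
  have hterm : ∀ ν : Fin P.d, ‖(E ⟨x.unshift ν, ν⟩ + E ⟨(x.unshift ν).shift ν, μ⟩ - E ⟨(x.unshift ν).shift μ, ν⟩ - E ⟨x.unshift ν, μ⟩)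
      - (E ⟨x, ν⟩ + E ⟨x.shift ν, μ⟩ - E ⟨x.shift μ, ν⟩ - E ⟨x, μ⟩)‖ ≤ 4 * q := by
    intro ν
    have h1 := hq x ν ν
    have h2 : ‖E ⟨(x.unshift ν).shift ν, μ⟩ - E ⟨x.shift ν, μ⟩‖ ≤ q := by
      have := hq (x.shift ν) μ ν
      rw [s2] at this
      rw [s1]
      exact this
    have h3 : ‖E ⟨(x.unshift ν).shift μ, ν⟩ - E ⟨x.shift μ, ν⟩‖ ≤ q := by
      have := hq (x.shift μ) ν ν; rwa [← s3] at this
    have h4 := hq x μ ν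
    have e1 : (E ⟨x.unshift ν, ν⟩ + E ⟨(x.unshift ν).shift ν, μ⟩ - E ⟨(x.unshift ν).shift μ, ν⟩ - E ⟨x.unshift ν, μ⟩)
        - (E ⟨x, ν⟩ + E ⟨x.shift ν, μ⟩ - E ⟨x.shift μ, ν⟩ - E ⟨x, μ⟩)
        = ((E ⟨x.unshift ν, ν⟩ - E ⟨x, ν⟩) + (E ⟨(x.unshift ν).shift ν, μ⟩ - E ⟨x.shift ν, μ⟩))
          - ((E ⟨(x.unshift ν).shift μ, ν⟩ - E ⟨x.shift μ, ν⟩) + (E ⟨x.unshift ν, μ⟩ - E ⟨x, μ⟩)) := by abel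
    rw [e1]
    calc _ ≤ ‖(E ⟨x.unshift ν, ν⟩ - E ⟨x, ν⟩) + (E ⟨(x.unshift ν).shift ν, μ⟩ - E ⟨x.shift ν, μ⟩)‖
          + ‖(E ⟨(x.unshift ν).shift μ, ν⟩ - E ⟨x.shift μ, ν⟩) + (E ⟨x.unshift ν, μ⟩ - E ⟨x, μ⟩)‖ := norm_sub_le _ _
      _ ≤ (q + q) + (q + q) :=
          add_le_add ((norm_add_le _ _).trans (add_le_add h1 h2)) ((norm_add_le _ _).trans (add_le_add h3 h4))
      _ = 4 * q := by ring
  calc _ ≤ ∑ ν : Fin P.d, ‖(E ⟨x.unshift ν, ν⟩ + E ⟨(x.unshift ν).shift ν, μ⟩ - E ⟨(x.unshift ν).shift μ, ν⟩ - E ⟨x.unshift ν, μ⟩)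
        - (E ⟨x, ν⟩ + E ⟨x.shift ν, μ⟩ - E ⟨x.shift μ, ν⟩ - E ⟨x, μ⟩)‖ := norm_sum_le _ _
    _ ≤ ∑ _ν : Fin P.d, 4 * q := Finset.sum_le_sum fun ν _ => hterm ν
    _ = 4 * P.d * q := by rw [Finset.sum_const, Finset.card_univ, Fintype.card_fin, nsmul_eq_mul]; ring

/-- **THE CHART FORM**: as `abs_component_le_of_slice_of_EL_T3`, but the real component is taken of an ARBITRARY bond field `A` (e.g. the Lie-algebra
coordinate of `V = exp A`, on which the Landau gauge of [Balaban1985RegularSpaces] Thm 2/4 is imposed) whose translation differences are within `q` of those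
of `V − 1`: `‖[(V − 1) − A](s − e_ν, κ) − [(V − 1) − A](s, κ)‖ ≤ q` (for `A = log V`: `q = O(a·g)`, the consumer's one-liner).  Then for `x = ℓ∘A` on the
flat slice with `c²·ℓ∘(D^{1*}_V∂V)` a multiplier current: `|x(e)| ≤ C_G·B′ + C_H·(β + C_G·B′)`, `B′ = c²·(3·(2af + 2f² + 16ag) + 12·q)`.
[cite: Balaban1985Variational, (127) p.297, (133)-(136) p.298; Balaban1985RegularSpaces, (1.36) p.82, (1.136) p.99] -/
theorem abs_component_le_of_slice_of_EL_chart_T3 (F : T3Family) (n K : ℕ)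
    {w : BondIdx (twoScale (K - n) (succ_le_T3 F n K) (∅ : Finset (Site (F.P K) (K - n + 1)))) → ℝ}
    (hw : ∀ i, 0 < w i) (hwa : ∀ p, w p = ((F.L : ℝ) ^ (K - n)) ^ 3)
    (V : GaugeField (F.P K) 0 (Matrix (Fin 2) (Fin 2) ℂ)ˣ) (hV : ∀ b, V b ∈ unitaryUnits (Matrix (Fin 2) (Fin 2) ℂ))
    {a f g q : ℝ} (ha : 0 ≤ a) (hf : 0 ≤ f) (hg : 0 ≤ g)
    (haV : ∀ b, ‖(V b : Matrix (Fin 2) (Fin 2) ℂ) - 1‖ ≤ a)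
    (hfV : ∀ (s : Site (F.P K) 0) (κ μ : Fin 3), ‖plaqFT V κ μ s - 1‖ ≤ f)
    (hgV : ∀ (s : Site (F.P K) 0) (κ ν : Fin 3), ‖(V ⟨s.unshift ν, κ⟩ : Matrix (Fin 2) (Fin 2) ℂ) - V ⟨s, κ⟩‖ ≤ g)
    (A : PBond (F.P K) 0 → Matrix (Fin 2) (Fin 2) ℂ)
    (hq : ∀ (s : Site (F.P K) 0) (κ ν : Fin 3),
      ‖(((V ⟨s.unshift ν, κ⟩ : Matrix (Fin 2) (Fin 2) ℂ) - 1) - A ⟨s.unshift ν, κ⟩) - (((V ⟨s, κ⟩ : Matrix (Fin 2) (Fin 2) ℂ) - 1) - A ⟨s, κ⟩)‖ ≤ q)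
    (ℓ : Matrix (Fin 2) (Fin 2) ℂ →L[ℝ] ℝ) (hℓ : ‖ℓ‖ ≤ 1)
    (x : BondSpace (F.P K)) (hx : ∀ b, x b = ℓ (A b))
    (hslice : RE (twoScale (K - n) (succ_le_T3 F n K) (∅ : Finset (Site (F.P K) (K - n + 1)))) ((F.L : ℝ) ^ (K - n))
      (dsE ((F.L : ℝ) ^ (K - n)) x) = 0)
    (hEL : ∀ δ : BondSpace (F.P K), QE (twoScale (K - n) (succ_le_T3 F n K) (∅ : Finset (Site (F.P K) (K - n + 1)))) δ = 0 →
      ⟪δ, WithLp.toLp 2 (fun b : PBond (F.P K) 0 => ((F.L : ℝ) ^ (K - n)) ^ 2 * ℓ (covDivT 1 V b.dir b.src))⟫_ℝ = 0)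
    {β : ℝ} (hβ : ∀ c', |bondAvgIter (K - n) (WithLp.ofLp x) c'| ≤ β) (e : PBond (F.P K) 0) :
    |x e| ≤ (16 * Real.exp (1 / 6) * latticeConst 3 (1 / 6) + 3 * (MD183 3 2 * periodConst (kappa183 3) 2 * latticeConst 3 (kappa183 3 / 3)))
        * (((F.L : ℝ) ^ (K - n)) ^ 2 * (3 * (2 * a * f + 2 * f ^ 2 + 16 * a * g) + 12 * q))
      + MG163 3 * periodConst (kappa163 3) 2 * (3 * latticeConst 3 (kappa163 3 / 3))
        * (β + (16 * Real.exp (1 / 6) * latticeConst 3 (1 / 6)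
            + 3 * (MD183 3 2 * periodConst (kappa183 3) 2 * latticeConst 3 (kappa183 3 / 3)))
            * (((F.L : ℝ) ^ (K - n)) ^ 2 * (3 * (2 * a * f + 2 * f ^ 2 + 16 * a * g) + 12 * q))) := by
  set c : ℝ := (F.L : ℝ) ^ (K - n) with hc
  set r : BondSpace (F.P K) := WithLp.toLp 2 (fun b : PBond (F.P K) 0 => c ^ 2 * ℓ (covDivT 1 V b.dir b.src)) - dcsE c (dcE c x) with hr
  have hcrit : ∀ δ : BondSpace (F.P K), QE (twoScale (K - n) (succ_le_T3 F n K) (∅ : Finset (Site (F.P K) (K - n + 1)))) δ = 0 →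
      ⟪δ, dcsE c (dcE c x) + r⟫_ℝ = 0 := by
    intro δ hδ
    rw [hr, add_sub_cancel]
    exact hEL δ hδ
  -- the bond field `E = (V − 1) − A`
  set E : PBond (F.P K) 0 → Matrix (Fin 2) (Fin 2) ℂ := fun b => ((V b : Matrix (Fin 2) (Fin 2) ℂ) - 1) - A b with hE
  have hEq : ∀ (s : Site (F.P K) 0) (κ ν : Fin (F.P K).d), ‖E ⟨s.unshift ν, κ⟩ - E ⟨s, κ⟩‖ ≤ q := fun s κ ν => hq s κ ν
  have hrB : ∀ e', |r e'| ≤ c ^ 2 * (3 * (2 * a * f + 2 * f ^ 2 + 16 * a * g) + 12 * q) := by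
    intro e'
    have hflat := norm_div2_curl_sub_covDivT_le_T3 F K V hV ha hf hg haV hfV hgV e'.src e'.dir
    have hEop := norm_flatOp_le_of_shift_diff E hEq e'.src e'.dir
    have hd3 : ((F.P K).d : ℝ) = 3 := by norm_num [show (F.P K).d = 3 from rfl]
    rw [hd3] at hEop
    have hlin : ℓ (∑ ν : Fin 3,
        ((A ⟨e'.src.unshift ν, ν⟩ + A ⟨(e'.src.unshift ν).shift ν, e'.dir⟩ - A ⟨(e'.src.unshift ν).shift e'.dir, ν⟩ - A ⟨e'.src.unshift ν, e'.dir⟩)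
          - (A ⟨e'.src, ν⟩ + A ⟨e'.src.shift ν, e'.dir⟩ - A ⟨e'.src.shift e'.dir, ν⟩ - A ⟨e'.src, e'.dir⟩)))
        = ∑ ν : Fin 3,
          ((x ⟨e'.src.unshift ν, ν⟩ + x ⟨(e'.src.unshift ν).shift ν, e'.dir⟩ - x ⟨(e'.src.unshift ν).shift e'.dir, ν⟩ - x ⟨e'.src.unshift ν, e'.dir⟩)
            - (x ⟨e'.src, ν⟩ + x ⟨e'.src.shift ν, e'.dir⟩ - x ⟨e'.src.shift e'.dir, ν⟩ - x ⟨e'.src, e'.dir⟩)) := by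
      simp only [map_sum, map_sub, map_add, hx]
    have hd : dcsE c (dcE c x) e' = c ^ 2 * ∑ ν : Fin 3,
          ((x ⟨e'.src.unshift ν, ν⟩ + x ⟨(e'.src.unshift ν).shift ν, e'.dir⟩ - x ⟨(e'.src.unshift ν).shift e'.dir, ν⟩ - x ⟨e'.src.unshift ν, e'.dir⟩)
            - (x ⟨e'.src, ν⟩ + x ⟨e'.src.shift ν, e'.dir⟩ - x ⟨e'.src.shift e'.dir, ν⟩ - x ⟨e'.src, e'.dir⟩)) :=
      dcsE_dcE_apply c x e'
    -- the flat operator is additive in the field: `flatop(V − 1) − flatop(A) = flatop(E)`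
    have hsplit : (∑ ν : Fin 3,
        ((((V ⟨e'.src.unshift ν, ν⟩ : Matrix (Fin 2) (Fin 2) ℂ) - 1) + ((V ⟨(e'.src.unshift ν).shift ν, e'.dir⟩ : Matrix (Fin 2) (Fin 2) ℂ) - 1)
            - ((V ⟨(e'.src.unshift ν).shift e'.dir, ν⟩ : Matrix (Fin 2) (Fin 2) ℂ) - 1) - ((V ⟨e'.src.unshift ν, e'.dir⟩ : Matrix (Fin 2) (Fin 2) ℂ) - 1))
          - (((V ⟨e'.src, ν⟩ : Matrix (Fin 2) (Fin 2) ℂ) - 1) + ((V ⟨e'.src.shift ν, e'.dir⟩ : Matrix (Fin 2) (Fin 2) ℂ) - 1)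
            - ((V ⟨e'.src.shift e'.dir, ν⟩ : Matrix (Fin 2) (Fin 2) ℂ) - 1) - ((V ⟨e'.src, e'.dir⟩ : Matrix (Fin 2) (Fin 2) ℂ) - 1))))
        - (∑ ν : Fin 3,
          ((A ⟨e'.src.unshift ν, ν⟩ + A ⟨(e'.src.unshift ν).shift ν, e'.dir⟩ - A ⟨(e'.src.unshift ν).shift e'.dir, ν⟩ - A ⟨e'.src.unshift ν, e'.dir⟩)
            - (A ⟨e'.src, ν⟩ + A ⟨e'.src.shift ν, e'.dir⟩ - A ⟨e'.src.shift e'.dir, ν⟩ - A ⟨e'.src, e'.dir⟩)))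
        = ∑ ν : Fin 3, ((E ⟨e'.src.unshift ν, ν⟩ + E ⟨(e'.src.unshift ν).shift ν, e'.dir⟩ - E ⟨(e'.src.unshift ν).shift e'.dir, ν⟩
            - E ⟨e'.src.unshift ν, e'.dir⟩) - (E ⟨e'.src, ν⟩ + E ⟨e'.src.shift ν, e'.dir⟩ - E ⟨e'.src.shift e'.dir, ν⟩ - E ⟨e'.src, e'.dir⟩)) := by
      rw [← Finset.sum_sub_distrib]
      exact Finset.sum_congr rfl fun ν _ => by simp only [hE]; abel
    have hre : r e' = c ^ 2 * (ℓ (covDivT 1 V e'.dir e'.src - ∑ ν : Fin 3,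
        ((((V ⟨e'.src.unshift ν, ν⟩ : Matrix (Fin 2) (Fin 2) ℂ) - 1) + ((V ⟨(e'.src.unshift ν).shift ν, e'.dir⟩ : Matrix (Fin 2) (Fin 2) ℂ) - 1)
            - ((V ⟨(e'.src.unshift ν).shift e'.dir, ν⟩ : Matrix (Fin 2) (Fin 2) ℂ) - 1) - ((V ⟨e'.src.unshift ν, e'.dir⟩ : Matrix (Fin 2) (Fin 2) ℂ) - 1))
          - (((V ⟨e'.src, ν⟩ : Matrix (Fin 2) (Fin 2) ℂ) - 1) + ((V ⟨e'.src.shift ν, e'.dir⟩ : Matrix (Fin 2) (Fin 2) ℂ) - 1)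
            - ((V ⟨e'.src.shift e'.dir, ν⟩ : Matrix (Fin 2) (Fin 2) ℂ) - 1) - ((V ⟨e'.src, e'.dir⟩ : Matrix (Fin 2) (Fin 2) ℂ) - 1))))
        + ℓ (∑ ν : Fin 3, ((E ⟨e'.src.unshift ν, ν⟩ + E ⟨(e'.src.unshift ν).shift ν, e'.dir⟩ - E ⟨(e'.src.unshift ν).shift e'.dir, ν⟩
            - E ⟨e'.src.unshift ν, e'.dir⟩) - (E ⟨e'.src, ν⟩ + E ⟨e'.src.shift ν, e'.dir⟩ - E ⟨e'.src.shift e'.dir, ν⟩ - E ⟨e'.src, e'.dir⟩)))) := by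
      rw [hr, PiLp.sub_apply, hd, ← hlin, ← hsplit, map_sub, map_sub]
      ring
    rw [hre, abs_mul, abs_of_nonneg (by positivity : (0 : ℝ) ≤ c ^ 2)]
    refine mul_le_mul_of_nonneg_left ?_ (by positivity)
    have key : ∀ v : Matrix (Fin 2) (Fin 2) ℂ, |ℓ v| ≤ ‖v‖ := fun v => by
      have h := ℓ.le_opNorm v
      rw [Real.norm_eq_abs] at h
      exact h.trans (mul_le_of_le_one_left (norm_nonneg v) hℓ)
    refine (abs_add_le _ _).trans (add_le_add ((key _).trans ?_) ((key _).trans (hEop.trans (by norm_num))))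
    rw [norm_sub_rev]
    exact hflat
  exact abs_le_of_critical_T3 F n K hw hwa x r hslice hcrit hrB hβ e

end Summit.QuantumFields.YangMills.Theorems.Prop7FlatSliceRegularityNonlinear

end
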